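import Summits.ValiantsHypothesis.ValiantsHypothesis.Theorems.SOSTauSOSTauStubPosOfRobustShallow

/-!
# Crux `SOSTau.SOSTau` (stmt-ValiantsHypothesis-18748), line `Sketch`: stub `stub_posOfRobustShallowGen`

Threshold-parametric version of the bookkeeping stub `stub_posOfRobustShallow` for Dutta's SOS-τ
conjecture.  For a real weighted sum of squares `F = Σᵢ aᵢ gᵢ²` with majorant `M = Σᵢ |aᵢ| gᵢ²` and
support-sum `S = Σᵢ |supp gᵢ|`, sort the distinct positive zeros `z₀ < z₁ < ⋯ < z_N` of `F` and split the
`N` excursions `[z_k, z_{k+1}]` at a threshold `η` into SHALLOW ones (`|F| ≤ η M` on the whole closed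
interval) and ROBUST ones (some interior point `t` with `η M(t) < |F(t)|`; the point is interior because
`F` vanishes and `η M ≥ 0` at the endpoints).  Hypothesis 1 bounds the robust indices by `C_η · S` for
EVERY threshold `η ∈ (0,1)` and every representation; hypothesis 2 bounds the shallow indices by `C · S`
for SOME threshold `η₀ ∈ (0,1)` and SUPPORT-MINIMAL representations of `F ≠ 0`.  Specialising
hypothesis 1 at `η₀` and choosing a support-minimal representation of the same polynomial
(`exists_minimal_rep`; its support-sum `S*` satisfies `1 ≤ S* ≤ S` when `F ≠ 0`) gives
`#{positive distinct zeros} = N + 1 ≤ (C_R + C_Sh) · S* + 1 ≤ (C_R + C_Sh + 1) · S`.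

No analytic input: pure finite bookkeeping over Mathlib (`Finset.orderEmbOfFin`,
`Finset.card_filter_add_card_filter_not`, `Polynomial.mem_roots`) and the helpers of the threshold-`1/2`
file (`majorant_eval_nonneg`, `one_le_supportSum`, `exists_minimal_rep`).
-/

set_option linter.dupNamespace false

open Polynomial
open scoped BigOperators

namespace Summit.ValiantsHypothesis.ValiantsHypothesis.Theorems.SOSTauSOSTau

/-- **Core count (abstract form, general threshold).** If `F ≠ 0`, `M ≥ 0` pointwise, `0 ≤ η`, every
set of `η`-robust excursion indices along positive zeros of `F` has at most `B_R` elements and every set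
of `η`-shallow ones at most `B_Sh`, then `F` has at most `B_R + B_Sh + 1` distinct positive zeros: sort
them as `z₀ < ⋯ < z_N` and split `Fin N`. -/
theorem card_filter_pos_roots_leGen {F M : ℝ[X]} {η : ℝ} {BR BSh : ℕ} (hF : F ≠ 0) (hη : 0 ≤ η)
    (hM : ∀ t, 0 ≤ M.eval t)
    (hR : ∀ (N : ℕ) (z : Fin (N + 1) → ℝ) (K : Finset (Fin N)), StrictMono z → 0 < z 0 →
      (∀ k, F.eval (z k) = 0) →
      (∀ k ∈ K, ∃ t : ℝ, z k.castSucc < t ∧ t < z k.succ ∧ η * M.eval t < |F.eval t|) →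
      K.card ≤ BR)
    (hSh : ∀ (N : ℕ) (z : Fin (N + 1) → ℝ) (K : Finset (Fin N)), StrictMono z → 0 < z 0 →
      (∀ k, F.eval (z k) = 0) →
      (∀ k ∈ K, ∀ t : ℝ, z k.castSucc ≤ t → t ≤ z k.succ → |F.eval t| ≤ η * M.eval t) →
      K.card ≤ BSh) :
    (F.roots.toFinset.filter (fun x => 0 < x)).card ≤ BR + BSh + 1 := by
  classical
  rcases hN : (F.roots.toFinset.filter (fun x => 0 < x)).card with _ | N
  · exact Nat.zero_le _
  -- the sorted positive distinct zeros `z₀ < z₁ < ⋯ < z_N`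
  obtain ⟨z, hzmono, hzmem⟩ : ∃ z : Fin (N + 1) → ℝ, StrictMono z ∧
      ∀ k, z k ∈ F.roots.toFinset.filter (fun x => 0 < x) :=
    ⟨_, (Finset.orderEmbOfFin _ hN).strictMono, Finset.orderEmbOfFin_mem _ hN⟩
  have hzpos : ∀ k, 0 < z k := fun k => (Finset.mem_filter.mp (hzmem k)).2
  have hzroot : ∀ k, F.eval (z k) = 0 := fun k => by
    have h := (Finset.mem_filter.mp (hzmem k)).1
    rw [Multiset.mem_toFinset, Polynomial.mem_roots hF] at h
    exact h
  -- shallow / robust dichotomy of the `N` excursions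
  let Psh : Fin N → Prop := fun k =>
    ∀ t : ℝ, z k.castSucc ≤ t → t ≤ z k.succ → |F.eval t| ≤ η * M.eval t
  have hsum : (Finset.univ.filter Psh).card + (Finset.univ.filter fun k => ¬ Psh k).card = N := by
    rw [Finset.card_filter_add_card_filter_not, Finset.card_univ, Fintype.card_fin]
  have hrob : (Finset.univ.filter fun k => ¬ Psh k).card ≤ BR := by
    refine hR N z (Finset.univ.filter fun k => ¬ Psh k) hzmono (hzpos 0) hzroot fun k hk => ?_
    have hk' : ¬ Psh k := (Finset.mem_filter.mp hk).2
    obtain ⟨t, h1, h2, hlt⟩ :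
        ∃ t : ℝ, z k.castSucc ≤ t ∧ t ≤ z k.succ ∧ η * M.eval t < |F.eval t| := by
      by_contra hcon
      exact hk' fun t h1 h2 => not_lt.mp fun hlt => hcon ⟨t, h1, h2, hlt⟩
    refine ⟨t, lt_of_le_of_ne h1 fun h => ?_, lt_of_le_of_ne h2 fun h => ?_, hlt⟩
    · subst h
      rw [hzroot, abs_zero] at hlt
      exact absurd hlt (not_lt.mpr (mul_nonneg hη (hM (z k.castSucc))))
    · subst h
      rw [hzroot, abs_zero] at hlt
      exact absurd hlt (not_lt.mpr (mul_nonneg hη (hM (z k.succ))))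
  have hsh : (Finset.univ.filter Psh).card ≤ BSh :=
    hSh N z (Finset.univ.filter Psh) hzmono (hzpos 0) hzroot fun k hk => (Finset.mem_filter.mp hk).2
  omega

/-- **Stub `stub_posOfRobustShallowGen`** (`Stmt.robustCountGen → Stmt.shallowCountSome → Stmt.posCount`
of the line `Sketch`): the robust count at EVERY threshold `η ∈ (0,1)` (hypothesis 1) and the shallow
count at SOME threshold `η₀ ∈ (0,1)` for support-minimal representations (hypothesis 2) bound the number
of distinct positive zeros of `Σ aᵢ gᵢ²` by `c · Σ |supp gᵢ|` with `c = C_R(η₀) + C_Sh + 1`. -/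
theorem stub_posOfRobustShallowGen :
    (∀ η : ℝ, 0 < η → η < 1 → ∃ C : ℕ, ∀ (s : ℕ) (a : Fin s → ℝ) (g : Fin s → ℝ[X]) (N : ℕ)
      (z : Fin (N + 1) → ℝ) (K : Finset (Fin N)),
      StrictMono z → 0 < z 0 →
      (∀ k, (∑ i, Polynomial.C (a i) * g i ^ 2).eval (z k) = 0) →
      (∀ k ∈ K, ∃ t : ℝ, z k.castSucc < t ∧ t < z k.succ ∧
        η * (∑ i, Polynomial.C (|a i|) * g i ^ 2).eval t < |(∑ i, Polynomial.C (a i) * g i ^ 2).eval t|) →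
      K.card ≤ C * ∑ i, (g i).support.card) →
    (∃ η : ℝ, 0 < η ∧ η < 1 ∧ ∃ C : ℕ, ∀ (s : ℕ) (a : Fin s → ℝ) (g : Fin s → ℝ[X]),
      (∀ (s' : ℕ) (a' : Fin s' → ℝ) (g' : Fin s' → ℝ[X]),
        (∑ i, Polynomial.C (a' i) * g' i ^ 2) = (∑ i, Polynomial.C (a i) * g i ^ 2) →
          ∑ i, (g i).support.card ≤ ∑ i, (g' i).support.card) →
      ∀ (N : ℕ) (z : Fin (N + 1) → ℝ) (K : Finset (Fin N)),
      StrictMono z → 0 < z 0 → (∑ i, Polynomial.C (a i) * g i ^ 2) ≠ 0 →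
      (∀ k, (∑ i, Polynomial.C (a i) * g i ^ 2).eval (z k) = 0) →
      (∀ k ∈ K, ∀ t : ℝ, z k.castSucc ≤ t → t ≤ z k.succ →
        |(∑ i, Polynomial.C (a i) * g i ^ 2).eval t| ≤ η * (∑ i, Polynomial.C (|a i|) * g i ^ 2).eval t) →
      K.card ≤ C * ∑ i, (g i).support.card) →
    ∃ c : ℕ, ∀ (s : ℕ) (a : Fin s → ℝ) (g : Fin s → ℝ[X]),
      ((∑ i, Polynomial.C (a i) * g i ^ 2).roots.toFinset.filter (fun x => 0 < x)).card ≤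
        c * ∑ i, (g i).support.card := by
  rintro hRall ⟨η, hη0, hη1, CSh, hSh⟩
  obtain ⟨CR, hR⟩ := hRall η hη0 hη1
  refine ⟨CR + CSh + 1, fun s a g => ?_⟩
  by_cases hF : (∑ i, Polynomial.C (a i) * g i ^ 2) = 0
  · rw [hF, Polynomial.roots_zero]
    simp
  -- a support-minimal representation of the same polynomial
  obtain ⟨s', a', g', hFeq, hS, hmin⟩ := exists_minimal_rep a g
  have hF' : (∑ i, Polynomial.C (a' i) * g' i ^ 2) ≠ 0 := by
    rw [hFeq]
    exact hF
  have hS1 : 1 ≤ ∑ i, (g' i).support.card := one_le_supportSum a' g' hF'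
  have hcore := card_filter_pos_roots_leGen (BR := CR * ∑ i, (g' i).support.card)
    (BSh := CSh * ∑ i, (g' i).support.card) hF' hη0.le (majorant_eval_nonneg a' g')
    (fun N z K hz h0 hroot hK => hR s' a' g' N z K hz h0 hroot hK)
    (fun N z K hz h0 hroot hK => hSh s' a' g' hmin N z K hz h0 hF' hroot hK)
  rw [hFeq] at hcore
  calc ((∑ i, Polynomial.C (a i) * g i ^ 2).roots.toFinset.filter (fun x => 0 < x)).card
      ≤ CR * ∑ i, (g' i).support.card + CSh * ∑ i, (g' i).support.card + 1 := hcore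
    _ ≤ CR * ∑ i, (g i).support.card + CSh * ∑ i, (g i).support.card +
          ∑ i, (g i).support.card :=
        add_le_add (add_le_add (Nat.mul_le_mul le_rfl hS) (Nat.mul_le_mul le_rfl hS)) (hS1.trans hS)
    _ = (CR + CSh + 1) * ∑ i, (g i).support.card := by ring

end Summit.ValiantsHypothesis.ValiantsHypothesis.Theorems.SOSTauSOSTau
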